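import Summits.MatrixMultiplication.MatrixMultiplication.Theorems.SoloBlindHypergraphTwo

/-!
# The hypergraph Kraft conjecture for three vertices; Conjecture E for targets with ≤ 3 representations

Sub-programme (K₃), H-good half; continuation of `SoloBlindHypergraphTwo`.  For an admissible hypergraph on
`F = {x, y, z}` the test functionals `2·𝟙_a + 2·𝟙_b` (an edge through `a, b`), `𝟙_a + 2·𝟙_b` with separation
(edges through `a` not `b` and through `b` not `a`) give every vertex degree `≥ 2`; a vertex `t` of degree
exactly `2` has star `{F, {t}}` or `{{t,s}, {t,r}}` (`soloBlind_hg3_star`); two vertices of degree `2` are then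
excluded by the functionals `𝟙_x + 𝟙_y + 𝟙_z` (total `0`) and `𝟙_x + 𝟙_y + 2·𝟙_z` (total `1`)
(`soloBlind_hg3_not_two_small`).  Hence the Kraft sum is `≤ 1/4 + 1/8 + 1/8 = 1/2`
(`soloBlind_hgKraft_le_of_card_eq_three`, `soloBlind_hgKraft_le_of_card_le_three`), and CONJECTURE E HOLDS
UNCONDITIONALLY AT EVERY H-GOOD TARGET WITH AT MOST THREE REPRESENTATIONS, in every rank
(`soloBlind_conjE_of_card_repAll_le_three`).
-/

namespace Summit.MatrixMultiplication.MatrixMultiplication.Theorems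

open Finset

universe u v

section Hypergraph

variable {W : Type*} [DecidableEq W]

/-- The three-point functional `a·𝟙_x + b·𝟙_y + d·𝟙_z`. -/
def soloBlindFn3 (x y z : W) (a b d : ZMod 3) : W → ZMod 3 :=
  fun v => if v = x then a else if v = y then b else if v = z then d else 0

omit [DecidableEq W] in
/-- A sum over three distinct points. -/
theorem soloBlind_sum_three {x y z : W} [DecidableEq W] (hxy : x ≠ y) (hxz : x ≠ z) (hyz : y ≠ z)
    {M : Type*} [AddCommMonoid M] (f : W → M) :
    ∑ v ∈ ({x, y, z} : Finset W), f v = f x + (f y + f z) := by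
  rw [Finset.sum_insert (by simp [hxy, hxz]), Finset.sum_insert (by simp [hyz]), Finset.sum_singleton]

/-- The total of the three-point functional. -/
theorem soloBlind_fn3_total {x y z : W} (hxy : x ≠ y) (hxz : x ≠ z) (hyz : y ≠ z) (a b d : ZMod 3) :
    ∑ v ∈ ({x, y, z} : Finset W), soloBlindFn3 x y z a b d v = a + (b + d) := by
  rw [soloBlind_sum_three hxy hxz hyz]
  simp [soloBlindFn3, hxy.symm, hxz.symm, hyz.symm]

/-- The value of the three-point functional on an edge `J ⊆ {x, y, z}`. -/
theorem soloBlind_fn3_val {x y z : W} (hxy : x ≠ y) (hxz : x ≠ z) (hyz : y ≠ z) (a b d : ZMod 3)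
    {J : Finset W} (hJ : J ⊆ ({x, y, z} : Finset W)) :
    soloBlindHgVal (soloBlindFn3 x y z a b d) J =
      (if x ∈ J then a else 0) + ((if y ∈ J then b else 0) + (if z ∈ J then d else 0)) := by
  have h3 : ∑ v ∈ ({x, y, z} : Finset W), (if v ∈ J then soloBlindFn3 x y z a b d v else 0) =
      (if x ∈ J then soloBlindFn3 x y z a b d x else 0) +
        ((if y ∈ J then soloBlindFn3 x y z a b d y else 0) +
          (if z ∈ J then soloBlindFn3 x y z a b d z else 0)) :=
    soloBlind_sum_three hxy hxz hyz (fun v => if v ∈ J then soloBlindFn3 x y z a b d v else 0)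
  have ex : soloBlindFn3 x y z a b d x = a := by simp [soloBlindFn3]
  have ey : soloBlindFn3 x y z a b d y = b := by simp [soloBlindFn3, hxy.symm]
  have ez : soloBlindFn3 x y z a b d z = d := by simp [soloBlindFn3, hxz.symm, hyz.symm]
  rw [ex, ey, ez, ← Finset.sum_filter, Finset.filter_mem_eq_inter, Finset.inter_eq_right.mpr hJ] at h3
  exact h3

omit [DecidableEq W] in
/-- Truth table: `𝟙 + 𝟙 + 𝟙` takes the value `1` iff exactly one indicator is on. -/
theorem soloBlind_tt_111_one (p q r : Prop) [Decidable p] [Decidable q] [Decidable r] :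
    (if p then (1 : ZMod 3) else 0) + ((if q then (1 : ZMod 3) else 0) + (if r then (1 : ZMod 3) else 0)) = 1 ↔
      (p ∧ ¬ q ∧ ¬ r) ∨ (¬ p ∧ q ∧ ¬ r) ∨ (¬ p ∧ ¬ q ∧ r) := by
  by_cases hp : p <;> by_cases hq : q <;> by_cases hr : r <;> simp [hp, hq, hr]
  all_goals decide

omit [DecidableEq W] in
/-- Truth table: `𝟙 + 𝟙 + 𝟙` takes the value `2` iff exactly two indicators are on. -/
theorem soloBlind_tt_111_two (p q r : Prop) [Decidable p] [Decidable q] [Decidable r] :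
    (if p then (1 : ZMod 3) else 0) + ((if q then (1 : ZMod 3) else 0) + (if r then (1 : ZMod 3) else 0)) = 2 ↔
      (p ∧ q ∧ ¬ r) ∨ (p ∧ ¬ q ∧ r) ∨ (¬ p ∧ q ∧ r) := by
  by_cases hp : p <;> by_cases hq : q <;> by_cases hr : r <;> simp [hp, hq, hr]
  all_goals decide

omit [DecidableEq W] in
/-- Truth table: `𝟙 + 𝟙 + 2·𝟙` takes the value `1` iff (first only), (second only) or (all three). -/
theorem soloBlind_tt_112_one (p q r : Prop) [Decidable p] [Decidable q] [Decidable r] :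
    (if p then (1 : ZMod 3) else 0) + ((if q then (1 : ZMod 3) else 0) + (if r then (2 : ZMod 3) else 0)) = 1 ↔
      (p ∧ ¬ q ∧ ¬ r) ∨ (¬ p ∧ q ∧ ¬ r) ∨ (p ∧ q ∧ r) := by
  by_cases hp : p <;> by_cases hq : q <;> by_cases hr : r <;> simp [hp, hq, hr]
  all_goals decide

omit [DecidableEq W] in
/-- Truth table: `2·𝟙 + 2·𝟙 + 0` takes the value `1` iff both are on. -/
theorem soloBlind_tt_220_one (p q r : Prop) [Decidable p] [Decidable q] [Decidable r] :
    (if p then (2 : ZMod 3) else 0) + ((if q then (2 : ZMod 3) else 0) + (if r then (0 : ZMod 3) else 0)) = 1 ↔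
      (p ∧ q) := by
  by_cases hp : p <;> by_cases hq : q <;> by_cases hr : r <;> simp [hp, hq, hr]
  all_goals decide

omit [DecidableEq W] in
/-- Truth table: `𝟙 + 2·𝟙 + 0` takes the value `1` iff (first, not second), the value `2` iff (second, not first). -/
theorem soloBlind_tt_120 (p q r : Prop) [Decidable p] [Decidable q] [Decidable r] :
    ((if p then (1 : ZMod 3) else 0) + ((if q then (2 : ZMod 3) else 0) + (if r then (0 : ZMod 3) else 0)) = 1 ↔
      (p ∧ ¬ q)) ∧
    ((if p then (1 : ZMod 3) else 0) + ((if q then (2 : ZMod 3) else 0) + (if r then (0 : ZMod 3) else 0)) = 2 ↔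
      (q ∧ ¬ p)) := by
  by_cases hp : p <;> by_cases hq : q <;> by_cases hr : r <;> simp [hp, hq, hr]
  all_goals decide

/-- An edge through `x` and `y` (test functional `2·𝟙_x + 2·𝟙_y`, total `1`). -/
theorem soloBlind_hg3_pair {x y z : W} (hxy : x ≠ y) (hxz : x ≠ z) (hyz : y ≠ z) {P : Finset (Finset W)}
    (hP3 : ∀ J ∈ P, J ⊆ ({x, y, z} : Finset W)) (hadm : soloBlindHgAdmissible ({x, y, z} : Finset W) P) :
    ∃ J ∈ P, x ∈ J ∧ y ∈ J := by
  obtain ⟨_, h1, _⟩ := hadm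
  obtain ⟨J, hJ, hv⟩ := h1 (soloBlindFn3 x y z 2 2 0) (by rw [soloBlind_fn3_total hxy hxz hyz]; decide)
  rw [soloBlind_fn3_val hxy hxz hyz 2 2 0 (hP3 J hJ), soloBlind_tt_220_one] at hv
  exact ⟨J, hJ, hv⟩

/-- Edges through `x` not `y` and through `y` not `x` (test functional `𝟙_x + 2·𝟙_y`, total `0`, + separation). -/
theorem soloBlind_hg3_sep {x y z : W} (hxy : x ≠ y) (hxz : x ≠ z) (hyz : y ≠ z) {P : Finset (Finset W)}
    (hP3 : ∀ J ∈ P, J ⊆ ({x, y, z} : Finset W)) (hadm : soloBlindHgAdmissible ({x, y, z} : Finset W) P) :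
    (∃ J ∈ P, x ∈ J ∧ y ∉ J) ∧ (∃ J ∈ P, y ∈ J ∧ x ∉ J) := by
  obtain ⟨hsep, _, h0⟩ := hadm
  have hiff := h0 (soloBlindFn3 x y z 1 2 0) (by rw [soloBlind_fn3_total hxy hxz hyz]; decide)
  have to1 : (∃ J ∈ P, soloBlindHgVal (soloBlindFn3 x y z 1 2 0) J = 1) ↔ ∃ J ∈ P, x ∈ J ∧ y ∉ J := by
    constructor
    · rintro ⟨J, hJ, hv⟩
      rw [soloBlind_fn3_val hxy hxz hyz 1 2 0 (hP3 J hJ), (soloBlind_tt_120 _ _ _).1] at hv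
      exact ⟨J, hJ, hv⟩
    · rintro ⟨J, hJ, hv⟩
      refine ⟨J, hJ, ?_⟩
      rw [soloBlind_fn3_val hxy hxz hyz 1 2 0 (hP3 J hJ), (soloBlind_tt_120 _ _ _).1]; exact hv
  have to2 : (∃ J ∈ P, soloBlindHgVal (soloBlindFn3 x y z 1 2 0) J = 2) ↔ ∃ J ∈ P, y ∈ J ∧ x ∉ J := by
    constructor
    · rintro ⟨J, hJ, hv⟩
      rw [soloBlind_fn3_val hxy hxz hyz 1 2 0 (hP3 J hJ), (soloBlind_tt_120 _ _ _).2] at hv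
      exact ⟨J, hJ, hv⟩
    · rintro ⟨J, hJ, hv⟩
      refine ⟨J, hJ, ?_⟩
      rw [soloBlind_fn3_val hxy hxz hyz 1 2 0 (hP3 J hJ), (soloBlind_tt_120 _ _ _).2]; exact hv
  rw [to1, to2] at hiff
  obtain ⟨J₀, hJ₀, hne⟩ := hsep x (by simp) y (by simp) hxy
  by_cases hx0 : x ∈ J₀
  · have hy0 : y ∉ J₀ := fun hy0 => hne ⟨fun _ => hy0, fun _ => hx0⟩
    exact ⟨⟨J₀, hJ₀, hx0, hy0⟩, hiff.mp ⟨J₀, hJ₀, hx0, hy0⟩⟩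
  · have hy0 : y ∈ J₀ := by
      by_contra hy0; exact hne ⟨fun h => absurd h hx0, fun h => absurd h hy0⟩
    exact ⟨hiff.mpr ⟨J₀, hJ₀, hy0, hx0⟩, ⟨J₀, hJ₀, hy0, hx0⟩⟩

/-- Two distinct edges through `t` give degree `≥ 2`. -/
theorem soloBlind_hg3_deg_two {t s : W} {P : Finset (Finset W)} (hp : ∃ J ∈ P, t ∈ J ∧ s ∈ J)
    (hn : ∃ J ∈ P, t ∈ J ∧ s ∉ J) : 2 ≤ soloBlindHgDeg P t := by
  obtain ⟨A, hA, htA, hsA⟩ := hp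
  obtain ⟨C, hC, htC, hsC⟩ := hn
  have hne : A ≠ C := fun h => hsC (h ▸ hsA)
  unfold soloBlindHgDeg
  calc 2 = ({A, C} : Finset (Finset W)).card := (Finset.card_pair hne).symm
    _ ≤ _ := Finset.card_le_card (fun J hJ => by
        rcases Finset.mem_insert.mp hJ with rfl | hJ
        · exact Finset.mem_filter.mpr ⟨hA, htA⟩
        · rw [Finset.mem_singleton.mp hJ]; exact Finset.mem_filter.mpr ⟨hC, htC⟩)

/-- THE STAR OF A DEGREE-`2` VERTEX `t`: it is `{A, C}` with `t, s ∈ A`, `t ∈ C ∌ s`, and either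
(`r ∈ A`, `r ∉ C`) or (`r ∉ A`, `r ∈ C`). -/
theorem soloBlind_hg3_star {t s r : W} {P : Finset (Finset W)} (hps : ∃ J ∈ P, t ∈ J ∧ s ∈ J)
    (hpr : ∃ J ∈ P, t ∈ J ∧ r ∈ J) (hns : ∃ J ∈ P, t ∈ J ∧ s ∉ J) (hnr : ∃ J ∈ P, t ∈ J ∧ r ∉ J)
    (hdeg : soloBlindHgDeg P t ≤ 2) :
    ∃ A ∈ P, ∃ C ∈ P, (∀ J ∈ P, t ∈ J → J = A ∨ J = C) ∧ t ∈ A ∧ s ∈ A ∧ t ∈ C ∧ s ∉ C ∧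
      ((r ∈ A ∧ r ∉ C) ∨ (r ∉ A ∧ r ∈ C)) := by
  obtain ⟨A, hA, htA, hsA⟩ := hps
  obtain ⟨C, hC, htC, hsC⟩ := hns
  have hne : A ≠ C := fun h => hsC (h ▸ hsA)
  unfold soloBlindHgDeg at hdeg
  have hsub : ({A, C} : Finset (Finset W)) ⊆ P.filter (fun J => t ∈ J) := fun J hJ => by
    rcases Finset.mem_insert.mp hJ with rfl | hJ
    · exact Finset.mem_filter.mpr ⟨hA, htA⟩
    · rw [Finset.mem_singleton.mp hJ]; exact Finset.mem_filter.mpr ⟨hC, htC⟩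
  have hfilt : ({A, C} : Finset (Finset W)) = P.filter (fun J => t ∈ J) :=
    Finset.eq_of_subset_of_card_le hsub (by rw [Finset.card_pair hne]; exact hdeg)
  have hall : ∀ J ∈ P, t ∈ J → J = A ∨ J = C := by
    intro J hJ htJ
    have hmem : J ∈ P.filter (fun J => t ∈ J) := Finset.mem_filter.mpr ⟨hJ, htJ⟩
    rw [← hfilt] at hmem
    simpa using hmem
  refine ⟨A, hA, C, hC, hall, htA, hsA, htC, hsC, ?_⟩
  obtain ⟨B, hB, htB, hrB⟩ := hpr
  obtain ⟨D, hD, htD, hrD⟩ := hnr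
  rcases hall B hB htB with rfl | rfl
  · rcases hall D hD htD with rfl | rfl
    · exact absurd hrB hrD
    · exact Or.inl ⟨hrB, hrD⟩
  · rcases hall D hD htD with rfl | rfl
    · exact Or.inr ⟨hrD, hrB⟩
    · exact absurd hrB hrD

/-- TWO VERTICES OF DEGREE `≤ 2` ARE IMPOSSIBLE on three vertices. -/
theorem soloBlind_hg3_not_two_small {x y z : W} (hxy : x ≠ y) (hxz : x ≠ z) (hyz : y ≠ z)
    {P : Finset (Finset W)} (hP3 : ∀ J ∈ P, J ⊆ ({x, y, z} : Finset W))
    (hadm : soloBlindHgAdmissible ({x, y, z} : Finset W) P)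
    (hpxy : ∃ J ∈ P, x ∈ J ∧ y ∈ J) (hpxz : ∃ J ∈ P, x ∈ J ∧ z ∈ J) (hpyz : ∃ J ∈ P, y ∈ J ∧ z ∈ J)
    (hsxy : ∃ J ∈ P, x ∈ J ∧ y ∉ J) (hsyx : ∃ J ∈ P, y ∈ J ∧ x ∉ J)
    (hsxz : ∃ J ∈ P, x ∈ J ∧ z ∉ J) (hsyz : ∃ J ∈ P, y ∈ J ∧ z ∉ J) :
    ¬ (soloBlindHgDeg P x ≤ 2 ∧ soloBlindHgDeg P y ≤ 2) := by
  rintro ⟨hdx, hdy⟩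
  obtain ⟨_, h1, h0⟩ := hadm
  obtain ⟨A, hA, C, hC, allx, hxA, hyA, hxC, hyC, hzx⟩ := soloBlind_hg3_star hpxy hpxz hsxy hsxz hdx
  have hpyx : ∃ J ∈ P, y ∈ J ∧ x ∈ J := by
    obtain ⟨J, hJ, h⟩ := hpxy; exact ⟨J, hJ, h.2, h.1⟩
  obtain ⟨A', hA', C', hC', ally, hyA', hxA', hyC', hxC', hzy⟩ := soloBlind_hg3_star hpyx hpyz hsyx hsyz hdy
  -- the edge `A ∋ x, y` lies in the star of `y`, and is not `C' ∌ x`: so `A = A'`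
  have hAA' : A = A' := by
    rcases ally A hA hyA with h | h
    · exact h
    · exact absurd (h ▸ hxA) hxC'
  subst hAA'
  rcases hzx with ⟨hzA, hzC⟩ | ⟨hzA, hzC⟩ <;> rcases hzy with ⟨hzA', hzC'⟩ | ⟨hzA', hzC'⟩
  · -- stars `{F, {x}}` and `{F, {y}}`: the functional `𝟙_x + 𝟙_y + 𝟙_z` (total `0`) takes `1` on `{x}` …
    have hiff := h0 (soloBlindFn3 x y z 1 1 1) (by rw [soloBlind_fn3_total hxy hxz hyz]; decide)
    have hone : ∃ J ∈ P, soloBlindHgVal (soloBlindFn3 x y z 1 1 1) J = 1 := by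
      refine ⟨C, hC, ?_⟩
      rw [soloBlind_fn3_val hxy hxz hyz 1 1 1 (hP3 C hC), soloBlind_tt_111_one]
      exact Or.inl ⟨hxC, hyC, hzC⟩
    -- … but the value `2` on no edge
    obtain ⟨J, hJ, hv⟩ := hiff.mp hone
    rw [soloBlind_fn3_val hxy hxz hyz 1 1 1 (hP3 J hJ), soloBlind_tt_111_two] at hv
    rcases hv with ⟨hxJ, hyJ, hzJ⟩ | ⟨hxJ, hyJ, hzJ⟩ | ⟨hxJ, hyJ, hzJ⟩
    · rcases allx J hJ hxJ with rfl | rfl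
      · exact hzJ hzA
      · exact hyC hyJ
    · rcases allx J hJ hxJ with rfl | rfl
      · exact hyJ hyA
      · exact hzC hzJ
    · rcases ally J hJ hyJ with rfl | rfl
      · exact hxJ hxA
      · exact hzC' hzJ
  · exact hzA' hzA
  · exact hzA hzA'
  · -- stars `{{x,y},{x,z}}` and `{{x,y},{y,z}}`: the functional `𝟙_x + 𝟙_y + 2·𝟙_z` (total `1`) never takes `1`
    obtain ⟨J, hJ, hv⟩ := h1 (soloBlindFn3 x y z 1 1 2) (by rw [soloBlind_fn3_total hxy hxz hyz]; decide)
    rw [soloBlind_fn3_val hxy hxz hyz 1 1 2 (hP3 J hJ), soloBlind_tt_112_one] at hv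
    rcases hv with ⟨hxJ, hyJ, hzJ⟩ | ⟨hxJ, hyJ, hzJ⟩ | ⟨hxJ, hyJ, hzJ⟩
    · rcases allx J hJ hxJ with rfl | rfl
      · exact hyJ hyA
      · exact hzJ hzC
    · rcases ally J hJ hyJ with rfl | rfl
      · exact hxJ hxA
      · exact hzJ hzC'
    · rcases allx J hJ hxJ with rfl | rfl
      · exact hzA hzJ
      · exact hyC hyJ

/-- THE HYPERGRAPH KRAFT CONJECTURE FOR THREE VERTICES. -/
theorem soloBlind_hgKraft_le_of_card_eq_three (F : Finset W) (P : Finset (Finset W))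
    (hPF : ∀ J ∈ P, J ⊆ F) (hadm : soloBlindHgAdmissible F P) (hcard : F.card = 3) :
    soloBlindHgKraft F P ≤ 1 / 2 := by
  obtain ⟨x, y, z, hxy, hxz, hyz, rfl⟩ := Finset.card_eq_three.mp hcard
  have e_xzy : ({x, z, y} : Finset W) = {x, y, z} := by
    ext v; simp only [Finset.mem_insert, Finset.mem_singleton]; tauto
  have e_yzx : ({y, z, x} : Finset W) = {x, y, z} := by
    ext v; simp only [Finset.mem_insert, Finset.mem_singleton]; tauto
  have hP_xzy : ∀ J ∈ P, J ⊆ ({x, z, y} : Finset W) := by rw [e_xzy]; exact hPF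
  have hP_yzx : ∀ J ∈ P, J ⊆ ({y, z, x} : Finset W) := by rw [e_yzx]; exact hPF
  have hA_xzy : soloBlindHgAdmissible ({x, z, y} : Finset W) P := by rw [e_xzy]; exact hadm
  have hA_yzx : soloBlindHgAdmissible ({y, z, x} : Finset W) P := by rw [e_yzx]; exact hadm
  have pxy := soloBlind_hg3_pair hxy hxz hyz hPF hadm
  have pxz := soloBlind_hg3_pair hxz hxy hyz.symm hP_xzy hA_xzy
  have pyz := soloBlind_hg3_pair hyz hxy.symm hxz.symm hP_yzx hA_yzx
  have sxy := soloBlind_hg3_sep hxy hxz hyz hPF hadm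
  have sxz := soloBlind_hg3_sep hxz hxy hyz.symm hP_xzy hA_xzy
  have syz := soloBlind_hg3_sep hyz hxy.symm hxz.symm hP_yzx hA_yzx
  have swap : ∀ {a b : W}, (∃ J ∈ P, a ∈ J ∧ b ∈ J) → ∃ J ∈ P, b ∈ J ∧ a ∈ J :=
    fun ⟨J, hJ, h⟩ => ⟨J, hJ, h.2, h.1⟩
  -- all degrees ≥ 2
  have dx := soloBlind_hg3_deg_two pxy sxy.1
  have dy := soloBlind_hg3_deg_two (swap pxy) sxy.2
  have dz := soloBlind_hg3_deg_two (swap pxz) sxz.2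
  -- no two degrees ≤ 2
  have nxy := soloBlind_hg3_not_two_small hxy hxz hyz hPF hadm pxy pxz pyz sxy.1 sxy.2 sxz.1 syz.1
  have nxz := soloBlind_hg3_not_two_small hxz hxy hyz.symm hP_xzy hA_xzy pxz pxy (swap pyz) sxz.1 sxz.2
    sxy.1 syz.2
  have nyz := soloBlind_hg3_not_two_small hyz hxy.symm hxz.symm hP_yzx hA_yzx pyz (swap pxy) (swap pxz)
    syz.1 syz.2 sxy.2 sxz.2
  -- numerics
  have q2 : ∀ n : ℕ, 2 ≤ n → (1 / 2 : ℚ) ^ n ≤ 1 / 4 := fun n hn =>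
    calc (1 / 2 : ℚ) ^ n ≤ (1 / 2) ^ 2 := pow_le_pow_of_le_one (by norm_num) (by norm_num) hn
      _ = 1 / 4 := by norm_num
  have q3 : ∀ n : ℕ, ¬ n ≤ 2 → (1 / 2 : ℚ) ^ n ≤ 1 / 8 := fun n hn =>
    calc (1 / 2 : ℚ) ^ n ≤ (1 / 2) ^ 3 := pow_le_pow_of_le_one (by norm_num) (by norm_num) (by omega)
      _ = 1 / 8 := by norm_num
  unfold soloBlindHgKraft
  rw [soloBlind_sum_three hxy hxz hyz]
  by_cases hx2 : soloBlindHgDeg P x ≤ 2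
  · have hy3 : ¬ soloBlindHgDeg P y ≤ 2 := fun h => nxy ⟨hx2, h⟩
    have hz3 : ¬ soloBlindHgDeg P z ≤ 2 := fun h => nxz ⟨hx2, h⟩
    linarith [q2 _ dx, q3 _ hy3, q3 _ hz3]
  · by_cases hy2 : soloBlindHgDeg P y ≤ 2
    · have hz3 : ¬ soloBlindHgDeg P z ≤ 2 := fun h => nyz ⟨hy2, h⟩
      linarith [q3 _ hx2, q2 _ dy, q3 _ hz3]
    · linarith [q3 _ hx2, q3 _ hy2, q2 _ dz]

/-- THE HYPERGRAPH KRAFT CONJECTURE FOR AT MOST THREE VERTICES. -/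
theorem soloBlind_hgKraft_le_of_card_le_three (F : Finset W) (P : Finset (Finset W))
    (hPF : ∀ J ∈ P, J ⊆ F) (hadm : soloBlindHgAdmissible F P) (hcard : F.card ≤ 3) :
    soloBlindHgKraft F P ≤ 1 / 2 := by
  by_cases h3 : F.card = 3
  · exact soloBlind_hgKraft_le_of_card_eq_three F P hPF hadm h3
  · exact soloBlind_hgKraft_le_of_card_le_two F P hPF hadm (by omega)

end Hypergraph

variable {ι : Type v} [DecidableEq ι]
variable {G : Type u} [AddCommGroup G] [DecidableEq G]

/-- CONJECTURE E AT TARGETS WITH AT MOST THREE REPRESENTATIONS (unconditional, every rank): if `σ` is H-good for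
the zero-sum-free `h` on `S` in a group of exponent `3` and has at most three representations, then
`soloBlindMass h S σ ≤ 1/2`. -/
theorem soloBlind_conjE_of_card_repAll_le_three (three : ∀ g : G, g + g + g = 0) (h : ι → G) (S : Finset ι)
    (σ : G) (zsf : ∀ T ⊆ S, T.Nonempty → ∑ i ∈ T, h i ≠ 0) (hgood : ∀ T ⊆ S, ∑ i ∈ T, h i ≠ σ + σ)
    (hN : (soloBlindSeqRepAll h S σ).card ≤ 3) : soloBlindMass h S σ ≤ 1 / 2 :=
  (soloBlind_mass_le_hgKraft h S σ).trans
    (soloBlind_hgKraft_le_of_card_le_three _ _ (soloBlind_atomHg_edge_subset h S σ)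
      (soloBlind_atomHg_admissible three zsf hgood) hN)

end Summit.MatrixMultiplication.MatrixMultiplication.Theorems
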